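import Summits.Ventures.PercRepro.S1EightSixRankFiveNine

/-!
# PercRepro — THE SHAPE `(rank 5 on 9) ⊕ (rank 3 on 5)` OF THE `(8, 6)` CELL, THE CONSUMER (p2, gen 28;
SUBCLAIM-S1 §6.10 (xvii)(p); PARTIAL — towards the `(8, 6)` capstone)

With the profile of `S1EightSixRankFiveNine`: `N_M(5, 4) ≤ s₅`, `N_M(5, 3) ≤ q₃ + s₆`, `N_M(5, 2) ≤ q₂ + t + s₇`,
`#U ≤ N_M(5, 4) + 5 N_M(5, 3) + 10 N_M(5, 2)`, `#Y ≥ 13 f_M(2) + 23 f_M(3) + 28 f_M(4) + 16 f_M(5)`, the kill bound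
`q₂ + q₃ ≤ 126 − s₅` (the extension incidence), `t ≤ 36`, `q₂ ≤ 18`, `p₅ ≤ 3`: `Φ(8, 4) · #U ≤ #Y` (linarith; margin
`≥ 250`). Nothing is claimed about any cell.

* the complements by size; `c025_eight_four_disjointSum_five_nine_three_five`.
Axioms: standard.
-/

open scoped Matroid

namespace PercRepro

namespace S1

open Set

variable {α : Type}

section Complements

variable {M : Matroid α} [M.Finite]

/-- The sizes of a member of `N(5, k)` and of its complement. -/
theorem sizes_of_profileSet_five (hE : M.E.ncard = 9) {k : ℕ} {A : Set α} (hA : A ∈ profileSet M 5 k) :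
    5 ≤ A.ncard ∧ k ≤ (M.E \ A).ncard ∧ A.ncard + (M.E \ A).ncard = 9 := by
  obtain ⟨hAE, hA5, hAc⟩ := hA
  have hAfin : A.Finite := M.ground_finite.subset hAE
  have h1 : ((5 : ℕ) : ℕ∞) ≤ (A.ncard : ℕ∞) := by
    rw [← hA5, hAfin.cast_ncard_eq]; exact M.eRk_le_encard A
  have h2 : ((k : ℕ) : ℕ∞) ≤ ((M.E \ A).ncard : ℕ∞) := by
    rw [← hAc, (M.ground_finite.subset sdiff_subset).cast_ncard_eq]; exact M.eRk_le_encard _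
  have h3 : A.ncard + (M.E \ A).ncard = M.E.ncard := by
    rw [← ncard_union_eq disjoint_sdiff_right hAfin (M.ground_finite.subset sdiff_subset), union_sdiff_cancel hAE]
  exact ⟨by exact_mod_cast h1, by exact_mod_cast h2, by rw [h3, hE]⟩

/-- `N_M(5, 4) ≤ s₅`. -/
theorem ncard_profileSet_five_four_le (hE : M.E.ncard = 9) : (profileSet M 5 4).ncard ≤ (rkSets M 5 5).ncard := by
  refine ncard_le_ncard (fun A hA => ?_) (rkSets_finite 5 5)
  obtain ⟨h1, h2, h3⟩ := sizes_of_profileSet_five hE hA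
  exact ⟨hA.1, by omega, hA.2.1⟩

/-- `N_M(5, 3) ≤ q₃ + s₆`. -/
theorem ncard_profileSet_five_three_le (hE : M.E.ncard = 9) :
    (profileSet M 5 3).ncard ≤ (rkSets M 4 3).ncard + (rkSets M 6 5).ncard := by
  have hsub : profileSet M 5 3 ⊆ (fun T => M.E \ T) '' rkSets M 4 3 ∪ rkSets M 6 5 := by
    intro A hA
    obtain ⟨h1, h2, h3⟩ := sizes_of_profileSet_five hE hA
    obtain ⟨hAE, hA5, hAc⟩ := hA
    rcases Nat.lt_or_ge A.ncard 6 with h | h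
    · left; exact ⟨M.E \ A, ⟨sdiff_subset, by omega, hAc⟩, sdiff_sdiff_cancel_left hAE⟩
    · right; exact ⟨hAE, by omega, hA5⟩
  have h := ncard_le_ncard hsub (((rkSets_finite 4 3).image _).union (rkSets_finite 6 5))
  exact h.trans ((ncard_union_le _ _).trans (Nat.add_le_add_right (ncard_image_le (rkSets_finite 4 3)) _))

/-- `N_M(5, 2) ≤ q₂ + t + s₇`. -/
theorem ncard_profileSet_five_two_le (hE : M.E.ncard = 9) :
    (profileSet M 5 2).ncard ≤ (rankTwoSets M 4).ncard + (rankTwoSets M 3).ncard + (rkSets M 7 5).ncard := by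
  have hsub : profileSet M 5 2 ⊆ (fun T => M.E \ T) '' rankTwoSets M 4 ∪ (fun T => M.E \ T) '' rankTwoSets M 3 ∪
      rkSets M 7 5 := by
    intro A hA
    obtain ⟨h1, h2, h3⟩ := sizes_of_profileSet_five hE hA
    obtain ⟨hAE, hA5, hAc⟩ := hA
    -- the complement has rank `2`, hence at most `5` points; with `|A| ≥ 5` at most `4`
    rcases Nat.lt_or_ge A.ncard 6 with h | h
    · left; left; exact ⟨M.E \ A, ⟨sdiff_subset, by omega, hAc⟩, sdiff_sdiff_cancel_left hAE⟩
    rcases Nat.lt_or_ge A.ncard 7 with h' | h'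
    · left; right; exact ⟨M.E \ A, ⟨sdiff_subset, by omega, hAc⟩, sdiff_sdiff_cancel_left hAE⟩
    · right; exact ⟨hAE, by omega, hA5⟩
  have h := ncard_le_ncard hsub ((((rankTwoSets_finite M 4).image _).union ((rankTwoSets_finite M 3).image _)).union
    (rkSets_finite 7 5))
  refine h.trans ((ncard_union_le _ _).trans ?_)
  exact Nat.add_le_add_right ((ncard_union_le _ _).trans (Nat.add_le_add (ncard_image_le (rankTwoSets_finite M 4))
    (ncard_image_le (rankTwoSets_finite M 3)))) _

/-- The kill bound: `q₂ + q₃ ≤ #low4 ≤ #low5 ≤ 126 − s₅`. -/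
theorem kill_bound_rank_five_nine (hE : M.E.ncard = 9) :
    (rankTwoSets M 4).ncard + (rkSets M 4 3).ncard + (rkSets M 5 5).ncard ≤ 126 := by
  have hext := sub_mul_ncard_lowRankSets_le M 4 3
  rw [hE] at hext
  have hlow4 : (rankTwoSets M 4).ncard + (rkSets M 4 3).ncard ≤ (lowRankSets M 4 3).ncard := by
    have hsub : rankTwoSets M 4 ∪ rkSets M 4 3 ⊆ lowRankSets M 4 3 := by
      rintro Q (⟨hQE, h4, h2⟩ | ⟨hQE, h4, h3⟩)
      · exact ⟨hQE, h4, by rw [h2]; decide⟩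
      · exact ⟨hQE, h4, by rw [h3]⟩
    have h := ncard_le_ncard hsub (lowRankSets_finite M 4 3)
    rwa [ncard_union_eq (by
        rw [Set.disjoint_left]
        rintro Q ⟨-, -, h2⟩ ⟨-, -, h3⟩
        rw [h3] at h2; exact absurd h2 (by decide)) (rankTwoSets_finite M 4) (rkSets_finite 4 3)] at h
  have hlow5 : (lowRankSets M (4 + 1) (3 + 1)).ncard + (rkSets M 5 5).ncard ≤ 126 := by
    have hf5 : {A : Set α | A ⊆ M.E ∧ A.ncard = 5}.Finite := M.ground_finite.finite_subsets.subset (fun _ hA => hA.1)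
    have hsub : lowRankSets M (4 + 1) (3 + 1) ∪ rkSets M 5 5 ⊆ {A : Set α | A ⊆ M.E ∧ A.ncard = 5} := by
      rintro Q (⟨hQE, h5, -⟩ | ⟨hQE, h5, -⟩) <;> exact ⟨hQE, h5⟩
    have h := ncard_le_ncard hsub hf5
    rwa [ncard_union_eq (by
        rw [Set.disjoint_left]
        rintro Q ⟨-, -, hle⟩ ⟨-, -, h5⟩
        rw [h5] at hle
        exact absurd hle (by decide)) (lowRankSets_finite M (4 + 1) (3 + 1)) (rkSets_finite 5 5),
      ncard_setOf_subset_ncard_eq M.ground_finite 5, hE, show Nat.choose 9 5 = 126 by decide] at h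
  omega

end Complements

/-- The arithmetic of `(rank 5 on 9) ⊕ (rank 3 on 5)` at `(8, 4)`. -/
theorem consumer_arith_five_nine_three_five {u y t q2 p5 q3 u4 r53 r54 s5 r63 r64 s6 r74 s7 F2 F3 F4 F5 : ℚ}
    (hU : u ≤ s5 + 5 * (q3 + s6) + 10 * (q2 + t + s7)) (hY : 13 * F2 + 23 * F3 + 28 * F4 + 16 * F5 ≤ y)
    (hF2 : 36 + t + q2 ≤ F2) (hF3 : 84 - t + q3 + r53 + r63 ≤ F3) (hF4 : u4 + r54 + r64 + r74 ≤ F4)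
    (hF5 : 10 + s5 + s6 + s7 ≤ F5) (h4 : 126 ≤ q2 + q3 + u4) (h5 : 126 ≤ p5 + r53 + r54 + s5)
    (h6 : 84 ≤ r63 + r64 + s6) (h7 : 36 ≤ r74 + s7) (hkill : q2 + q3 + s5 ≤ 126)
    (ht : 3 * t ≤ 3 * 36) (hq2 : 6 * q2 ≤ 3 * 36) (hp5 : 10 * p5 ≤ 1 * 36) (hs6 : s6 ≤ 84) (hs7 : s7 ≤ 36)
    (hs5' : 0 ≤ s5) (hr54 : 0 ≤ r54) (hr64 : 0 ≤ r64) : 76 / 15 * u ≤ y := by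
  linarith

/-- **`M ⊕ N` at `(8, 4)`**: `M` coloop-free of rank `5` on `9` points, `N` coloop-free of rank `3` on `5` points,
both with all pairs of rank `2`. -/
theorem c025_eight_four_disjointSum_five_nine_three_five (M N : Matroid α) [M.Finite] [N.Finite]
    (h : Disjoint M.E N.E) (hM : M.eRank = ((5 : ℕ) : ℕ∞)) (hME : M.E.ncard = 9) (hcolM : M.coloops = ∅)
    (hpairsM : ∀ e ∈ M.E, ∀ f ∈ M.E, e ≠ f → M.eRk {e, f} = 2) (hN : N.eRank = ((3 : ℕ) : ℕ∞))
    (hNE : N.E.ncard = 5) (hcolN : N.coloops = ∅) (hpairsN : ∀ e ∈ N.E, ∀ f ∈ N.E, e ≠ f → N.eRk {e, f} = 2) :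
    phiK 8 4 * ({A : Set α | A ⊆ (M.disjointSum N h).E ∧ (M.disjointSum N h).eRk A = ((8 : ℕ) : ℕ∞) ∧
        (M.disjointSum N h).eRk ((M.disjointSum N h).E \ A) = ((4 : ℕ) : ℕ∞)}.ncard : ℚ) ≤
      ({A : Set α | A ⊆ (M.disjointSum N h).E ∧ ((4 : ℕ) : ℕ∞) < (M.disjointSum N h).eRk A ∧
        (M.disjointSum N h).eRk A < ((8 : ℕ) : ℕ∞)}.ncard : ℚ) := by
  have h54 := ncard_profileSet_five_four_le (M := M) hME
  have h53 := ncard_profileSet_five_three_le (M := M) hME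
  have h52 := ncard_profileSet_five_two_le (M := M) hME
  -- the `U`-side: the slices `(5, 2)`, `(5, 3)`, `(5, 4)`
  have hU : {A : Set α | A ⊆ (M.disjointSum N h).E ∧ (M.disjointSum N h).eRk A = ((8 : ℕ) : ℕ∞) ∧
      (M.disjointSum N h).eRk ((M.disjointSum N h).E \ A) = ((4 : ℕ) : ℕ∞)}.ncard ≤
      (rkSets M 5 5).ncard + 5 * ((rkSets M 4 3).ncard + (rkSets M 6 5).ncard) +
        10 * ((rankTwoSets M 4).ncard + (rankTwoSets M 3).ncard + (rkSets M 7 5).ncard) := by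
    rw [disjointSum_ncard_U_eq_finsum M N h 8 4, finsum_mem_coe_finset]
    have hsub : ({(5, 2), (5, 3), (5, 4)} : Finset (ℕ × ℕ)) ⊆ Finset.range (8 + 1) ×ˢ Finset.range (4 + 1) := by
      decide
    rw [← Finset.sum_subset hsub ?_]
    · rw [Finset.sum_insert (by decide), Finset.sum_insert (by decide), Finset.sum_singleton]
      dsimp only
      show (profileSet M 5 2).ncard * (profileSet N 3 2).ncard + ((profileSet M 5 3).ncard * (profileSet N 3 1).ncard +
        (profileSet M 5 4).ncard * (profileSet N 3 0).ncard) ≤ _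
      have g32 := ncard_profileSet_le_choose_of_ncard_eq (N := N) (a := 3) (b := 2) hNE
      rw [show Nat.choose (3 + 2) 3 = 10 by decide] at g32
      have g31 := ncard_profileSet_top_one_le_of_pairs' hpairsN 3
      rw [hNE] at g31
      have g30 := ncard_profileSet_top_zero_le_of_pairs N hpairsN (by omega) 3
      have e1 := Nat.mul_le_mul h52 g32
      have e2 := Nat.mul_le_mul h53 g31
      have e3 := Nat.mul_le_mul h54 g30
      linarith [e1, e2, e3]
    · rintro ⟨a, b⟩ hmem hnot
      rw [Finset.mem_product, Finset.mem_range, Finset.mem_range] at hmem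
      simp only [Finset.mem_insert, Finset.mem_singleton, Prod.mk.injEq, not_or] at hnot
      dsimp only
      rcases Nat.lt_or_ge 5 a with ha | ha
      · rw [profileSet_eq_empty_of_eRank_lt M hM ha b, ncard_empty, zero_mul]
      rcases Nat.lt_or_ge a 5 with ha' | ha'
      · have h8a : 3 < 8 - a := by omega
        rw [profileSet_eq_empty_of_eRank_lt N hN h8a (4 - b), ncard_empty, mul_zero]
      have ha5 : a = 5 := by omega
      subst ha5
      rw [show (8 : ℕ) - 5 = 3 from rfl]
      have hb : b < 2 := by omega
      rcases Nat.lt_or_ge b 1 with hb0 | hb1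
      · have hb0' : b = 0 := by omega
        subst hb0'
        rw [profileSet_eq_empty_of_eRank_lt_snd N hN (by norm_num) 3, ncard_empty, mul_zero]
      · have hb1' : b = 1 := by omega
        subst hb1'
        rw [profileSet_eq_empty_of_ncard_lt N (by rw [hNE]; norm_num : N.E.ncard < 3 + (4 - 1)), ncard_empty,
          mul_zero]
  -- the `Y`-side
  have hY : 13 * (rankSet M 2).ncard + 23 * (rankSet M 3).ncard + 28 * (rankSet M 4).ncard +
      16 * (rankSet M 5).ncard ≤
      {A : Set α | A ⊆ (M.disjointSum N h).E ∧ ((4 : ℕ) : ℕ∞) < (M.disjointSum N h).eRk A ∧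
        (M.disjointSum N h).eRk A < ((8 : ℕ) : ℕ∞)}.ncard := by
    rw [disjointSum_ncard_Y_eq_finsum M N h 8 4, finsum_mem_coe_finset]
    have hsub : ({(2, 3), (3, 2), (3, 3), (4, 1), (4, 2), (4, 3), (5, 0), (5, 1), (5, 2)} : Finset (ℕ × ℕ)) ⊆
        (Finset.range 8 ×ˢ Finset.range 8).filter (fun x : ℕ × ℕ => 4 < x.1 + x.2 ∧ x.1 + x.2 < 8) := by
      decide
    refine le_trans ?_ (Finset.sum_le_sum_of_subset hsub)
    rw [Finset.sum_insert (by decide), Finset.sum_insert (by decide), Finset.sum_insert (by decide),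
      Finset.sum_insert (by decide), Finset.sum_insert (by decide), Finset.sum_insert (by decide),
      Finset.sum_insert (by decide), Finset.sum_insert (by decide), Finset.sum_singleton]
    dsimp only
    have G0 : 1 ≤ (rankSet N 0).ncard := by
      have h0 : (∅ : Set α) ∈ rankSet N 0 := ⟨empty_subset _, by rw [N.eRk_empty]; rfl⟩
      exact (ncard_pos (rankSet_finite N 0)).mpr ⟨∅, h0⟩
    have G1 : 5 ≤ (rankSet N 1).ncard := by
      have := ncard_le_ncard_rankSet_one_of_pairs hpairsN (by omega)
      rwa [hNE] at this
    have G2 : 10 ≤ (rankSet N 2).ncard := by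
      have := choose_le_ncard_rankSet_two_of_pairs hpairsN
      rwa [hNE, show Nat.choose 5 2 = 10 by decide] at this
    have G3 := ncard_rankSet_three_ge_rank_three_five N hN hNE hcolN hpairsN
    have e23 := Nat.mul_le_mul_left (rankSet M 2).ncard G3
    have e32 := Nat.mul_le_mul_left (rankSet M 3).ncard G2
    have e33 := Nat.mul_le_mul_left (rankSet M 3).ncard G3
    have e41 := Nat.mul_le_mul_left (rankSet M 4).ncard G1
    have e42 := Nat.mul_le_mul_left (rankSet M 4).ncard G2
    have e43 := Nat.mul_le_mul_left (rankSet M 4).ncard G3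
    have e50 := Nat.mul_le_mul_left (rankSet M 5).ncard G0
    have e51 := Nat.mul_le_mul_left (rankSet M 5).ncard G1
    have e52 := Nat.mul_le_mul_left (rankSet M 5).ncard G2
    linarith
  -- the profile of `M`
  have hF2 := f2_ge_rank_five_nine hME hpairsM
  obtain ⟨hF3, hF4, hF5⟩ := f345_ge_rank_five_nine hM hME hcolM hpairsM
  obtain ⟨h4, h5, h6, h7⟩ := partitions_rank_five_nine hM hME hcolM hpairsM
  have hkill := kill_bound_rank_five_nine (M := M) hME
  have hcl : ∀ x ∈ M.E, ∀ y ∈ M.E, x ≠ y → (M.closure {x, y}).ncard ≤ 3 + 2 := by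
    intro x hx y hy hxy
    have := ncard_closure_pair_le_of_coloops' M hM (by norm_num) hcolM hpairsM hx hy hxy
    rw [hME] at this
    omega
  have ht := choose_mul_ncard_rankTwoSets_le M hpairsM (c := 3) (m := 3) hcl
  have hq2 := choose_mul_ncard_rankTwoSets_le M hpairsM (c := 3) (m := 4) hcl
  have hp5 := choose_mul_ncard_rankTwoSets_le M hpairsM (c := 3) (m := 5) hcl
  rw [hME, show Nat.choose 3 2 = 3 by decide, show Nat.choose 3 (3 - 2) = 3 by decide,
    show Nat.choose 9 2 = 36 by decide] at ht
  rw [hME, show Nat.choose 4 2 = 6 by decide, show Nat.choose 3 (4 - 2) = 3 by decide,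
    show Nat.choose 9 2 = 36 by decide] at hq2
  rw [hME, show Nat.choose 5 2 = 10 by decide, show Nat.choose 3 (5 - 2) = 1 by decide,
    show Nat.choose 9 2 = 36 by decide] at hp5
  have hs6 : (rkSets M 6 5).ncard ≤ 84 := by
    have hf6 : {A : Set α | A ⊆ M.E ∧ A.ncard = 6}.Finite := M.ground_finite.finite_subsets.subset (fun _ hA => hA.1)
    have := ncard_le_ncard (show rkSets M 6 5 ⊆ {A : Set α | A ⊆ M.E ∧ A.ncard = 6} from fun A hA => ⟨hA.1, hA.2.1⟩) hf6
    rwa [ncard_setOf_subset_ncard_eq M.ground_finite 6, hME, show Nat.choose 9 6 = 84 by decide] at this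
  have hs7 : (rkSets M 7 5).ncard ≤ 36 := by
    have hf7 : {A : Set α | A ⊆ M.E ∧ A.ncard = 7}.Finite := M.ground_finite.finite_subsets.subset (fun _ hA => hA.1)
    have := ncard_le_ncard (show rkSets M 7 5 ⊆ {A : Set α | A ⊆ M.E ∧ A.ncard = 7} from fun A hA => ⟨hA.1, hA.2.1⟩) hf7
    rwa [ncard_setOf_subset_ncard_eq M.ground_finite 7, hME, show Nat.choose 9 7 = 36 by decide] at this
  have ht84 : (rankTwoSets M 3).ncard ≤ 84 := by omega
  rw [phiK_eight_four]
  -- name the quantities, then cast once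
  generalize hu0 : {A : Set α | A ⊆ (M.disjointSum N h).E ∧ (M.disjointSum N h).eRk A = ((8 : ℕ) : ℕ∞) ∧
      (M.disjointSum N h).eRk ((M.disjointSum N h).E \ A) = ((4 : ℕ) : ℕ∞)}.ncard = u at hU ⊢
  generalize hy0 : {A : Set α | A ⊆ (M.disjointSum N h).E ∧ ((4 : ℕ) : ℕ∞) < (M.disjointSum N h).eRk A ∧
      (M.disjointSum N h).eRk A < ((8 : ℕ) : ℕ∞)}.ncard = y at hY ⊢
  generalize (rankTwoSets M 3).ncard = t at *
  generalize (rankTwoSets M 4).ncard = q2 at *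
  generalize (rankTwoSets M 5).ncard = p5 at *
  generalize (rkSets M 4 3).ncard = q3 at *
  generalize (rkSets M 4 4).ncard = u4 at *
  generalize (rkSets M 5 3).ncard = r53 at *
  generalize (rkSets M 5 4).ncard = r54 at *
  generalize (rkSets M 5 5).ncard = s5 at *
  generalize (rkSets M 6 3).ncard = r63 at *
  generalize (rkSets M 6 4).ncard = r64 at *
  generalize (rkSets M 6 5).ncard = s6 at *
  generalize (rkSets M 7 4).ncard = r74 at *
  generalize (rkSets M 7 5).ncard = s7 at *
  generalize (rankSet M 2).ncard = f2 at *
  generalize (rankSet M 3).ncard = f3 at *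
  generalize (rankSet M 4).ncard = f4 at *
  generalize (rankSet M 5).ncard = f5 at *
  have hF3' : (84 : ℚ) - t + q3 + r53 + r63 ≤ f3 := by
    have hc : ((84 - t + q3 + r53 + r63 : ℕ) : ℚ) = (84 : ℚ) - t + q3 + r53 + r63 := by
      push_cast [Nat.cast_sub ht84]; ring
    rw [← hc]; exact_mod_cast hF3
  exact consumer_arith_five_nine_three_five (u := (u : ℚ)) (y := (y : ℚ)) (t := (t : ℚ)) (q2 := (q2 : ℚ))
    (p5 := (p5 : ℚ)) (q3 := (q3 : ℚ)) (u4 := (u4 : ℚ)) (r53 := (r53 : ℚ)) (r54 := (r54 : ℚ)) (s5 := (s5 : ℚ))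
    (r63 := (r63 : ℚ)) (r64 := (r64 : ℚ)) (s6 := (s6 : ℚ)) (r74 := (r74 : ℚ)) (s7 := (s7 : ℚ)) (F2 := (f2 : ℚ))
    (F3 := (f3 : ℚ)) (F4 := (f4 : ℚ)) (F5 := (f5 : ℚ)) (by exact_mod_cast hU) (by exact_mod_cast hY)
    (by exact_mod_cast hF2) hF3' (by exact_mod_cast hF4) (by exact_mod_cast hF5) (by exact_mod_cast h4)
    (by exact_mod_cast h5) (by exact_mod_cast h6) (by exact_mod_cast h7) (by exact_mod_cast hkill)
    (by exact_mod_cast ht) (by exact_mod_cast hq2) (by exact_mod_cast hp5) (by exact_mod_cast hs6)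
    (by exact_mod_cast hs7) (Nat.cast_nonneg s5) (Nat.cast_nonneg r54) (Nat.cast_nonneg r64)

end S1

end PercRepro
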